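import Summits.BirchSwinnertonDyer.Rank1Residual.GaloisImage.KatoKuriharaValueGeneralLevelParity
import HarnessLib

/-!
# Route `KimAtThreeKolyvagin` (W2): the (P-EXP) rider ON THE TWISTED LATTICE and its consumption at a general
# tame level — KatoParity ★ / GeneralLevel ★★ ★ re-keyed (the Kato–Kurihara port on the good ANOMALOUS rows
# at `3`, rider side, file 1)

Cell `bsd-addord`, seat `bsd-addord-w2-c4` (gen 9; owner of crux 19599 `ShallowEqDeepOffKatoStratum`, item
19077 `ShallowEqDeepAtTorsionFree`).  `--supports` 19599.  HONEST FRAMING: TOOL THEOREMS ONLY (no definition,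
no named fact, no instance, no `sorry`); Kato's `ZetaBody` and the TWISTED rider clause enter as DISPLAYED
HYPOTHESES (`hbody`, `hfinτ`), never asserted; nothing is booked; 19599 / 19077 / 19560 stay OPEN; BSD is not
proved by any of this.  Credit: n1011-p13's `KatoParity.apply_localization_add_self_eq_toZModPow[_of_zetaBody_deriv]`
and `KatoValue.GeneralLevel.apply_localization_add_self_eq_toZModPow_of_derivativeFamily` /
`exists_unit_apply_localization_eq_of_derivativeFamily` — this file is those four theorems with ONE change: the
rider's scalar clause is the TWISTED one (below); every other step is BY NAME as there ((S1) `resSubgroup_eq_comp_map_deriv`,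
(S2) `localization_mem_of_isKolyvaginSystem`, the pin glue `comp_oneCocycleClass_eq_of_pin`, (T⁺1)/(T⁺2), n1011-p02's
`ZetaValue.zetaBody_apply_deriv_zeta_add_conjMap_eq_tmul_deriv`).

## The twisted rider clause (ii_τ) (displayed hypothesis `hfinτ`; the (Λ)-clauses (i) are unchanged and not used here)

For a depth `k`, a place `v ∣ p`, Kato's value datum `Λ` and a functional `Λfin : H¹(ℚ_v, E[p^k·p]) →+ ℤ/p^{k+1}`,
and the integer `a_p` (`ap`): for every tame level `r`, every `w ∈ (ℤ/n(r))ˣ` with `w·[p] = 1`, every admissible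
`Ψ`, every `y ∈ H¹(ℚ(μ_r), T_pW)`, `κ₀ ∈ H¹(ℚ, E[p^k·p])` with `res κ₀ = Ψ y` and `loc_v κ₀ ∈ 𝓕_can(v)`, and
every `s ∈ ℤ_p`:  IF `p • Λ_{0,r}(y) − (s·(p − a_p + 1)) ⊗ 1 ∈ p^{k+1} • (1 ⊗ P_w)·L_int`,
`P_w = p − a_pδ_w + δ_{w²}` (stated as `Σ_g (P_w)_g • (1 ⊗ σ_g) l`, `l ∈ L_int`), THEN `Λfin(loc_v κ₀) = s mod p^{k+1}`.
n1011's clause (ii) (`KatoExpStarFiniteLevelAt`, D-53-1) is the case `P = 1`, scalar `s`.  STATUS (the seat's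
LATTICE LEMMA, memo W2C4-ANOMALOUS-PORT-g9.md; a DERIVATION from [BK90] §3 local duality + formal groups, not
print): for `K/ℚ_p` finite unramified, `p ≥ 3`, `E` with good reduction at `p` and `E(K)[p] = 0`,
`exp*_ω(H¹(K, T)) = E_p(φ⁻¹)·𝓞_K`, `E_p(X) = 1 − a_pX/p + X²/p`, `φ` the arithmetic Frobenius ((φ² − a_pφ + p)
maps `E(K)` into `Ê(𝔪_K)` because `φ` acts on `Ẽ(k)` as the Frobenius endomorphism; `log_ω Ê(𝔪_K) = p𝓞_K`; both
sides have index `#Ẽ(k)[p^∞]` over `p𝓞_K`; trace duality); hence for Kato's witnesses (`Λ` = semi-local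
`exp*_ω ∘ loc_p`, `Λfin := exp*_ω / E_p(1) mod p^{k+1}`, `E_p(1) = #Ẽ(𝔽_p)/p`) clause (ii_τ) HOLDS at every tame
level of a good ANOMALOUS `t = 0` row (where `E(K)[p] = 0` for every unramified `K` by Kummer theory), and (i)
holds since `exp*_ω(H¹(ℚ_p,T)) = E_p(1)ℤ_p` (Kim AJM 148 Lemma 3.4).  It is an AXIOM on the bound witnesses here,
exactly as n1011's (ii) is (D-53-6); the value rows that meet its premise are the seat's
`KimAtThreeShallowEqDeepAnomalousValueRowsOfZetaBody.valueRow_twist_of_zetaBody`.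

## What
* §1 ★ `apply_localization_add_self_eq_toZModPow_twist` — (ii_τ) at the symmetrised pair `(y + g·y, κ₀ + κ₀)`;
  `…_of_zetaBody_deriv_twist` — the premise in VALUE form `p • (1 ⊗ 𝔇^{field}(x_{0,r} + σ₋₁x_{0,r}))` for
  THEOREM A3's derivative `y = D·z_{0,r}` (n1011-p02 ★ by name).
* §2 ★★ `apply_localization_add_self_eq_toZModPow_of_derivativeFamily_twist` / ★
  `exists_unit_apply_localization_eq_of_derivativeFamily_twist` — GeneralLevel ★★/★ for an ARBITRARY THEOREM-D
  output, with the twisted premise and `s̄ = w·p⁰·δ̃`: `∃ u, Λfin(loc_v κ_r) = u·p⁰·δ̃`.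
HONEST LIMITS: closes nothing; books nothing; 0 defs / 0 facts.

References: K. Kato, Astérisque 295 (2004) §9.4, Thm. 9.7 [Kato2004Asterisque]; C.-H. Kim, AJM 148 (2026) =
arXiv:2203.12159, Lemma 3.4, Cor. 3.5, §3.4.1 and the proof of Thm. 3.13 [Kim2022StructureSelmer]; S. Bloch,
K. Kato (1990) §3 [BlochKato1990]; B. Mazur, K. Rubin, Mem. AMS 799 (2004) Thm. 3.2.4, App. A [MazurRubin2004];
K. Rubin, *Euler Systems* (2000) Def. 4.4.4 [Rubin2000].
-/

noncomputable section

-- the Theorems namespace of a single-conjunct summit repeats the summit name by design (D-0017)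
set_option linter.dupNamespace false

open scoped NumberField TensorProduct
open CategoryTheory Field Finset IsDedekindDomain NumberField WeierstrassCurve Rat.HeightOneSpectrum
open Literature.NumberTheory.GaloisRepresentations Literature.NumberTheory.GaloisCohomology
open Literature.NumberTheory.GaloisRepresentations.DiscreteGaloisModule
open Literature.NumberTheory.EllipticCurves Literature.NumberTheory.EllipticCurves.Kato2004
open Literature.NumberTheory.EllipticCurves.Kato2004.EulerSystemValues
open Summit.BirchSwinnertonDyer.Rank1Residual.GaloisImage
open Summit.BirchSwinnertonDyer.Rank1Residual.GaloisImage.KatoValue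
open Summit.BirchSwinnertonDyer.Rank1Residual.GaloisImage.KatoValue.GeneralLevel

namespace Summit.BirchSwinnertonDyer.BirchSwinnertonDyer.Theorems.KimAtThreeShallowEqDeepAnomalousRider

/-! ### §1 The twisted scalar clause at the symmetrised pair -/

section Rider

variable {W : WeierstrassCurve ℚ} [W.IsElliptic] {p : ℕ} [Fact p.Prime]
  [ContinuousSMul ℤ_[p] (W.tateModule p)] {k : ℕ} {v : HeightOneSpectrum (𝓞 ℚ)}
  {Λ : ∀ (k' : ℕ) (r : Finset (HeightOneSpectrum (𝓞 ℚ))),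
    H1 (tateRep W p) (cycSubgroup p k' r) →ₗ[ℤ_[p]] ℚ_[p] ⊗[ℚ] CyclotomicField (cycLevel p k' r) ℚ}

set_option backward.isDefEq.respectTransparency false in
/-- **★ The PLUS-SYMMETRISED twisted scalar clause** ((ii_τ) at `(y + g·y, κ₀ + κ₀)`; n1011-p13's
`KatoParity.apply_localization_add_self_eq_toZModPow` with the twisted premise): `hres⁺` from (T⁺1)
`KatoParity.resSubgroup_add_self_eq_apply_add_conjMap`, `hloc⁺` from `KatoParity.localization_add_self_mem`.
[cite: Kim2022StructureSelmer, §3.4.1 and the proof of Thm. 3.13 (arXiv v3 pp. 26–27; = Thm. 3.11 of AJM 148)] -/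
theorem apply_localization_add_self_eq_toZModPow_twist
    {Λfin : galoisCohomology ((W.torsionGaloisModule ((p : ℤ) ^ k * (p : ℤ))).toLocal
      (Sum.inr v)) 1 →+ ZMod (p ^ (k + 1))} (ap : ℤ)
    -- the ANOMALOUS rider's scalar clause (ii_τ): the premise is stated on the TWISTED lattice `(1 ⊗ P_w)·L_int`,
    -- `P_w = p − a_pδ_w + δ_{w²}`, `w·[p] = 1`, with the scalar `s·(p − a_p + 1) = s·#Ẽ(𝔽_p)`
    (hfinτ : ∀ (r : Finset (HeightOneSpectrum (𝓞 ℚ))) (w : (ZMod (cycLevel p 0 r))ˣ),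
      (w : ZMod (cycLevel p 0 r)) * (p : ZMod (cycLevel p 0 r)) = 1 →
      ∀ (Ψ : H1 (tateRep W p) (cycSubgroup p 0 r) →+
          continuousCohomology 1
            (subgroupRep (W.torsionGaloisModule ((p : ℤ) ^ k * (p : ℤ))).toTopRep (cycSubgroup p 0 r))),
        (∀ (φ : contOneCocycles (subgroupRep (tateRep W p).toTopRep (cycSubgroup p 0 r)))
            (ψ : contOneCocycles
              (subgroupRep (W.torsionGaloisModule ((p : ℤ) ^ k * (p : ℤ))).toTopRep (cycSubgroup p 0 r))),
            (∀ g, ((ψ.1 g : geomTorsion W ((p : ℤ) ^ k * (p : ℤ))) : geomPoints W) =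
              TateModule.proj p (k + 1) (φ.1 g)) →
            Ψ (oneCocycleClass _ φ) = oneCocycleClass _ ψ) →
        ∀ (y : H1 (tateRep W p) (cycSubgroup p 0 r))
          (κ₀ : galoisCohomology (W.torsionGaloisModule ((p : ℤ) ^ k * (p : ℤ))) 1) (s : ℤ_[p]),
          resSubgroup (W.torsionGaloisModule ((p : ℤ) ^ k * (p : ℤ))).toTopRep (cycSubgroup p 0 r) 1 κ₀ =
              Ψ y →
          galoisCohomology.localization (W.torsionGaloisModule ((p : ℤ) ^ k * (p : ℤ))) (Sum.inr v) 1 κ₀ ∈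
              propagatedSelmerStructure W p k (Sum.inr v) →
          (∃ l ∈ cycIntLattice p (cycLevel p 0 r),
              (p : ℤ_[p]) • Λ 0 r y -
                  (((s * ((p : ℤ_[p]) - (ap : ℤ_[p]) + 1) : ℤ_[p]) : ℚ_[p]) ⊗ₜ[ℚ]
                    (1 : CyclotomicField (cycLevel p 0 r) ℚ)) =
                ((p : ℤ_[p]) ^ (k + 1)) • ∑ g : (ZMod (cycLevel p 0 r))ˣ,
                  (((((p : MonoidAlgebra ℤ_[p] (ZMod (cycLevel p 0 r))ˣ)) -
                      MonoidAlgebra.single w (ap : ℤ_[p]) +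
                      MonoidAlgebra.single (w ^ 2) (1 : ℤ_[p])).coeff g : ℤ_[p]) : ℚ_[p]) •
                    Algebra.TensorProduct.map (AlgHom.id ℚ ℚ_[p])
                      (sigma (cycLevel p 0 r) g : CyclotomicField (cycLevel p 0 r) ℚ →ₐ[ℚ]
                        CyclotomicField (cycLevel p 0 r) ℚ) l) →
          Λfin (galoisCohomology.localization (W.torsionGaloisModule ((p : ℤ) ^ k * (p : ℤ)))
              (Sum.inr v) 1 κ₀) = PadicInt.toZModPow (k + 1) s)
    (r : Finset (HeightOneSpectrum (𝓞 ℚ))) (w : (ZMod (cycLevel p 0 r))ˣ)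
    (hw₁ : (w : ZMod (cycLevel p 0 r)) * (p : ZMod (cycLevel p 0 r)) = 1)
    (Ψ : H1 (tateRep W p) (cycSubgroup p 0 r) →+
      continuousCohomology 1
        (subgroupRep (W.torsionGaloisModule ((p : ℤ) ^ k * (p : ℤ))).toTopRep (cycSubgroup p 0 r)))
    (hΨ : ∀ (φ : contOneCocycles (subgroupRep (tateRep W p).toTopRep (cycSubgroup p 0 r)))
        (ψ : contOneCocycles
          (subgroupRep (W.torsionGaloisModule ((p : ℤ) ^ k * (p : ℤ))).toTopRep (cycSubgroup p 0 r))),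
        (∀ g, ((ψ.1 g : geomTorsion W ((p : ℤ) ^ k * (p : ℤ))) : geomPoints W) =
          TateModule.proj p (k + 1) (φ.1 g)) →
        Ψ (oneCocycleClass _ φ) = oneCocycleClass _ ψ)
    (g : absoluteGaloisGroup ℚ) (y : H1 (tateRep W p) (cycSubgroup p 0 r))
    (κ₀ : galoisCohomology (W.torsionGaloisModule ((p : ℤ) ^ k * (p : ℤ))) 1) (s : ℤ_[p])
    (hres : resSubgroup (W.torsionGaloisModule ((p : ℤ) ^ k * (p : ℤ))).toTopRep (cycSubgroup p 0 r)
      1 κ₀ = Ψ y)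
    (hloc : galoisCohomology.localization (W.torsionGaloisModule ((p : ℤ) ^ k * (p : ℤ))) (Sum.inr v)
      1 κ₀ ∈ propagatedSelmerStructure W p k (Sum.inr v))
    (hval : ∃ l ∈ cycIntLattice p (cycLevel p 0 r),
      (p : ℤ_[p]) • Λ 0 r (y + conjMap (tateRep W p).toTopRep (cycSubgroup p 0 r) g 1 y) -
          (((s * ((p : ℤ_[p]) - (ap : ℤ_[p]) + 1) : ℤ_[p]) : ℚ_[p]) ⊗ₜ[ℚ]
            (1 : CyclotomicField (cycLevel p 0 r) ℚ)) =
        ((p : ℤ_[p]) ^ (k + 1)) • ∑ g : (ZMod (cycLevel p 0 r))ˣ,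
          (((((p : MonoidAlgebra ℤ_[p] (ZMod (cycLevel p 0 r))ˣ)) -
              MonoidAlgebra.single w (ap : ℤ_[p]) +
              MonoidAlgebra.single (w ^ 2) (1 : ℤ_[p])).coeff g : ℤ_[p]) : ℚ_[p]) •
            Algebra.TensorProduct.map (AlgHom.id ℚ ℚ_[p])
              (sigma (cycLevel p 0 r) g : CyclotomicField (cycLevel p 0 r) ℚ →ₐ[ℚ]
                CyclotomicField (cycLevel p 0 r) ℚ) l) :
    Λfin (galoisCohomology.localization (W.torsionGaloisModule ((p : ℤ) ^ k * (p : ℤ)))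
        (Sum.inr v) 1 (κ₀ + κ₀)) = PadicInt.toZModPow (k + 1) s :=
  hfinτ r w hw₁ Ψ hΨ _ (κ₀ + κ₀) s
    (KatoParity.resSubgroup_add_self_eq_apply_add_conjMap _ Ψ hΨ g y κ₀ hres)
    (KatoParity.localization_add_self_mem hloc) hval

end Rider

/-! ### §1b With Kato's `ZetaBody`: the premise in VALUE form for THEOREM A3's derivative -/

section Zeta

variable {W : WeierstrassCurve ℚ} [W.IsElliptic] {p : ℕ} [Fact p.Prime]
  [ContinuousSMul ℤ_[p] (W.tateModule p)] [Module.Free ℤ_[p] (W.tateModule p)]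
  [Module.Finite ℤ_[p] (W.tateModule p)] {N : ℕ} {f : CuspForm (CongruenceSubgroup.Gamma0 N) 2}
  {ι : (m : ℕ) → (CyclotomicField m ℚ →+* ℂ)} {κ : ℝ}
  {Λ : ∀ (k' : ℕ) (r : Finset (HeightOneSpectrum (𝓞 ℚ))),
    H1 (tateRep W p) (cycSubgroup p k' r) →ₗ[ℤ_[p]] ℚ_[p] ⊗[ℚ] CyclotomicField (cycLevel p k' r) ℚ}
  {c d a : ℤ} {A : ℕ}
  {z : ∀ (k' : ℕ) (r : (cyclotomicLevelsRat p (badPlaces c d A N)).Ideals),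
    H1 (tateRep W p) ((cyclotomicLevelsRat p (badPlaces c d A N)).level k' r.1)}
  {x : ∀ (k' : ℕ) (r : (cyclotomicLevelsRat p (badPlaces c d A N)).Ideals),
    CyclotomicField (cycLevel p k' r.1) ℚ}
  {k : ℕ} {v : HeightOneSpectrum (𝓞 ℚ)}

set_option backward.isDefEq.respectTransparency false in
/-- **★ The twisted clause for THEOREM A3's derivative `y = D · z_{0,r}`**: the premise is on the PURE TENSOR
`p • (1 ⊗ D^{field}(x_{0,r} + σ₋₁ x_{0,r}))` (n1011-p02 ★
`ZetaValue.zetaBody_apply_deriv_zeta_add_conjMap_eq_tmul_deriv`, PK-1 ★2 + (C3a)); n1011-p13's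
`KatoParity.apply_localization_add_self_eq_toZModPow_of_zetaBody_deriv` with the twisted premise.
[cite: Kato2004Asterisque, Thm. 9.7 (p. 189) and §9.4 (p. 188)]
[cite: Kim2022StructureSelmer, §3.4.1 and the proof of Thm. 3.13 (arXiv v3 pp. 26–27; = Thm. 3.11 of AJM 148)] -/
theorem apply_localization_add_self_eq_toZModPow_of_zetaBody_deriv_twist
    (hbody : ZetaBody W p f ι κ Λ c d a A z x)
    {Λfin : galoisCohomology ((W.torsionGaloisModule ((p : ℤ) ^ k * (p : ℤ))).toLocal
      (Sum.inr v)) 1 →+ ZMod (p ^ (k + 1))} (ap : ℤ)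
    -- the ANOMALOUS rider's scalar clause (ii_τ): the premise is stated on the TWISTED lattice `(1 ⊗ P_w)·L_int`,
    -- `P_w = p − a_pδ_w + δ_{w²}`, `w·[p] = 1`, with the scalar `s·(p − a_p + 1) = s·#Ẽ(𝔽_p)`
    (hfinτ : ∀ (r : Finset (HeightOneSpectrum (𝓞 ℚ))) (w : (ZMod (cycLevel p 0 r))ˣ),
      (w : ZMod (cycLevel p 0 r)) * (p : ZMod (cycLevel p 0 r)) = 1 →
      ∀ (Ψ : H1 (tateRep W p) (cycSubgroup p 0 r) →+
          continuousCohomology 1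
            (subgroupRep (W.torsionGaloisModule ((p : ℤ) ^ k * (p : ℤ))).toTopRep (cycSubgroup p 0 r))),
        (∀ (φ : contOneCocycles (subgroupRep (tateRep W p).toTopRep (cycSubgroup p 0 r)))
            (ψ : contOneCocycles
              (subgroupRep (W.torsionGaloisModule ((p : ℤ) ^ k * (p : ℤ))).toTopRep (cycSubgroup p 0 r))),
            (∀ g, ((ψ.1 g : geomTorsion W ((p : ℤ) ^ k * (p : ℤ))) : geomPoints W) =
              TateModule.proj p (k + 1) (φ.1 g)) →
            Ψ (oneCocycleClass _ φ) = oneCocycleClass _ ψ) →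
        ∀ (y : H1 (tateRep W p) (cycSubgroup p 0 r))
          (κ₀ : galoisCohomology (W.torsionGaloisModule ((p : ℤ) ^ k * (p : ℤ))) 1) (s : ℤ_[p]),
          resSubgroup (W.torsionGaloisModule ((p : ℤ) ^ k * (p : ℤ))).toTopRep (cycSubgroup p 0 r) 1 κ₀ =
              Ψ y →
          galoisCohomology.localization (W.torsionGaloisModule ((p : ℤ) ^ k * (p : ℤ))) (Sum.inr v) 1 κ₀ ∈
              propagatedSelmerStructure W p k (Sum.inr v) →
          (∃ l ∈ cycIntLattice p (cycLevel p 0 r),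
              (p : ℤ_[p]) • Λ 0 r y -
                  (((s * ((p : ℤ_[p]) - (ap : ℤ_[p]) + 1) : ℤ_[p]) : ℚ_[p]) ⊗ₜ[ℚ]
                    (1 : CyclotomicField (cycLevel p 0 r) ℚ)) =
                ((p : ℤ_[p]) ^ (k + 1)) • ∑ g : (ZMod (cycLevel p 0 r))ˣ,
                  (((((p : MonoidAlgebra ℤ_[p] (ZMod (cycLevel p 0 r))ˣ)) -
                      MonoidAlgebra.single w (ap : ℤ_[p]) +
                      MonoidAlgebra.single (w ^ 2) (1 : ℤ_[p])).coeff g : ℤ_[p]) : ℚ_[p]) •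
                    Algebra.TensorProduct.map (AlgHom.id ℚ ℚ_[p])
                      (sigma (cycLevel p 0 r) g : CyclotomicField (cycLevel p 0 r) ℚ →ₐ[ℚ]
                        CyclotomicField (cycLevel p 0 r) ℚ) l) →
          Λfin (galoisCohomology.localization (W.torsionGaloisModule ((p : ℤ) ^ k * (p : ℤ)))
              (Sum.inr v) 1 κ₀) = PadicInt.toZModPow (k + 1) s)
    (r : (cyclotomicLevelsRat p (badPlaces c d A N)).Ideals) (w : (ZMod (cycLevel p 0 r.1))ˣ)
    (hw₁ : (w : ZMod (cycLevel p 0 r.1)) * (p : ZMod (cycLevel p 0 r.1)) = 1)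
    (Ψ : H1 (tateRep W p) (cycSubgroup p 0 r.1) →+
      continuousCohomology 1
        (subgroupRep (W.torsionGaloisModule ((p : ℤ) ^ k * (p : ℤ))).toTopRep (cycSubgroup p 0 r.1)))
    (hΨ : ∀ (φ : contOneCocycles (subgroupRep (tateRep W p).toTopRep (cycSubgroup p 0 r.1)))
        (ψ : contOneCocycles
          (subgroupRep (W.torsionGaloisModule ((p : ℤ) ^ k * (p : ℤ))).toTopRep
            (cycSubgroup p 0 r.1))),
        (∀ g, ((ψ.1 g : geomTorsion W ((p : ℤ) ^ k * (p : ℤ))) : geomPoints W) =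
          TateModule.proj p (k + 1) (φ.1 g)) →
        Ψ (oneCocycleClass _ φ) = oneCocycleClass _ ψ)
    {ι' : Type*} (σ : ι' → absoluteGaloisGroup ℚ) (Nℓ : ι' → ℕ) (s' : Finset ι') (comm)
    {g : absoluteGaloisGroup ℚ} (hg : modNCyclotomicCharacter ℚ (cycLevel p 0 r.1) g = -1)
    (κ₀ : galoisCohomology (W.torsionGaloisModule ((p : ℤ) ^ k * (p : ℤ))) 1) (s : ℤ_[p])
    (hres : resSubgroup (W.torsionGaloisModule ((p : ℤ) ^ k * (p : ℤ))).toTopRep (cycSubgroup p 0 r.1)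
      1 κ₀ = Ψ (s'.noncommProd (fun ℓ => ∑ j ∈ Finset.range (Nℓ ℓ),
        (j : Module.End ℤ_[p] (H1 (tateRep W p) (cycSubgroup p 0 r.1))) *
          (conjMap (tateRep W p).toTopRep (cycSubgroup p 0 r.1) (σ ℓ) 1).hom.toLinearMap ^ j) comm
            (z 0 r)))
    (hloc : galoisCohomology.localization (W.torsionGaloisModule ((p : ℤ) ^ k * (p : ℤ))) (Sum.inr v)
      1 κ₀ ∈ propagatedSelmerStructure W p k (Sum.inr v))
    (hval : ∃ l ∈ cycIntLattice p (cycLevel p 0 r.1),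
      (p : ℤ_[p]) • ((1 : ℚ_[p]) ⊗ₜ[ℚ]
        (s'.noncommProd (fun ℓ => ∑ j ∈ Finset.range (Nℓ ℓ),
            (j : Module.End ℚ (CyclotomicField (cycLevel p 0 r.1) ℚ)) *
              (sigma (cycLevel p 0 r.1) (modNCyclotomicCharacter ℚ (cycLevel p 0 r.1) (σ ℓ)) :
                CyclotomicField (cycLevel p 0 r.1) ℚ →ₐ[ℚ]
                  CyclotomicField (cycLevel p 0 r.1) ℚ).toLinearMap ^ j)
            (ZetaValue.pairwise_commute_fieldDeriv (cycLevel p 0 r.1)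
              (fun ℓ => modNCyclotomicCharacter ℚ (cycLevel p 0 r.1) (σ ℓ)) Nℓ s')
          (x 0 r + sigma (cycLevel p 0 r.1) (-1) (x 0 r)))) -
          (((s * ((p : ℤ_[p]) - (ap : ℤ_[p]) + 1) : ℤ_[p]) : ℚ_[p]) ⊗ₜ[ℚ]
            (1 : CyclotomicField (cycLevel p 0 r.1) ℚ)) =
        ((p : ℤ_[p]) ^ (k + 1)) • ∑ g : (ZMod (cycLevel p 0 r.1))ˣ,
          (((((p : MonoidAlgebra ℤ_[p] (ZMod (cycLevel p 0 r.1))ˣ)) -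
              MonoidAlgebra.single w (ap : ℤ_[p]) +
              MonoidAlgebra.single (w ^ 2) (1 : ℤ_[p])).coeff g : ℤ_[p]) : ℚ_[p]) •
            Algebra.TensorProduct.map (AlgHom.id ℚ ℚ_[p])
              (sigma (cycLevel p 0 r.1) g : CyclotomicField (cycLevel p 0 r.1) ℚ →ₐ[ℚ]
                CyclotomicField (cycLevel p 0 r.1) ℚ) l) :
    Λfin (galoisCohomology.localization (W.torsionGaloisModule ((p : ℤ) ^ k * (p : ℤ)))
        (Sum.inr v) 1 (κ₀ + κ₀)) = PadicInt.toZModPow (k + 1) s := by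
  refine apply_localization_add_self_eq_toZModPow_twist ap hfinτ r.1 w hw₁ Ψ hΨ g _ κ₀ s hres hloc ?_
  rwa [ZetaValue.zetaBody_apply_deriv_zeta_add_conjMap_eq_tmul_deriv W p f ι κ Λ c d a A z x hbody 0
    r σ Nℓ s' comm hg]

end Zeta

end Summit.BirchSwinnertonDyer.BirchSwinnertonDyer.Theorems.KimAtThreeShallowEqDeepAnomalousRider

end
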